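import Summits.QuantumAdvantage.QuantumAdvantage.Theorems.SosSandwichTransferPBEventMachineDefs
import Summits.QuantumAdvantage.QuantumAdvantage.Theorems.SosSandwichTransferPBWalkMachineLength
import HarnessLib

/-!
# Crux `TransferPB` (stmt-QuantumAdvantage-15238, route SosSandwich), line `birth` — the SIZE INVARIANT of the event machine

For the event machine of `Theorems/SosSandwichTransferPBEventMachineDefs.lean`: the size invariant `EvInv W D` holds at
every reachable state and bounds the queries —

* `bump_eq_or`, `evInv_finish`, `evInv_proceed`, **`evInv_evDelta`** (the transition preserves `EvInv` together with the
  auxiliary MEAN-count bound `cnt < j`), **`evInv_evState`** (every state `evState W D bits` reached on any answer bits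
  satisfies `EvInv W D`), `evState_append_singleton`;
* **`length_query_le`** — a query asked in a state satisfying `EvInv W D` has length `≤ evQueryBound W D |x|`
  `= 2|x| + 2·D·(2W+4) + W + 50` (the four query shapes of `Theorems/SosSandwichTransferPBWalkMachineLength.lean`).

These give the query-length clause of `stub_pbOracleSimulation_of_stringMachines` for the event machine and keep the caps
of an `FP` implementation of `evDelta` inactive on reachable states. All proved; no named fact.
Sources: S. Arora, B. Barak, Computational Complexity (CUP 2009), §3.4; S. Aaronson, A. Ambainis, Theory Comput. 10
(2014), proof of Thm. 23 (p. 14).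
-/

-- D-0017: single-conjunct summit ⇒ the duplicate `QuantumAdvantage.QuantumAdvantage` is mandated.
set_option linter.dupNamespace false

noncomputable section

namespace Summit.QuantumAdvantage.QuantumAdvantage.Cruxes.TransferPB.Birth

open Finset Literature.Computability.Cryptography Literature.Computability.Complexity
  Literature.Computability.QuantumComplexity Literature.Computability.QuantumComplexity.ClassicalSimulation

namespace SimTreePB


section Invariant

variable (W D : ℕ)

/-- `bump` keeps the running candidate or replaces it by the live string at hand. [folklore] -/
theorem bump_eq_or (π : List (List Bool × Bool)) (b : Bool) (best : Option (List Bool)) (u : List Bool) :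
    bump π b best u = best ∨ bump π b best u = some u := by
  unfold bump
  split_ifs
  · cases best with
    | none => exact Or.inr rfl
    | some c =>
      show (if strNum u < strNum c then some u else some c) = some c ∨
        (if strNum u < strNum c then some u else some c) = some u
      split_ifs
      · exact Or.inr rfl
      · exact Or.inl rfl
  · exact Or.inl rfl

/-- `finish` preserves the size invariant. [folklore] -/
theorem evInv_finish {π : List (List Bool × Bool)} {d : ℕ} (hπ : ∀ e ∈ π, e.1.length < W) (hlen : π.length + d ≤ D)
    (hd : 1 ≤ d) {best : Option (List Bool)} (hbest : ∀ c, best = some c → c.length < W) :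
    EvInv W D (finish π d best) := by
  cases best with
  | none =>
    refine ⟨hπ, ?_, ?_⟩
    · show π.length + 0 ≤ D
      omega
    · show 1 ≤ 1 ∧ 1 ≤ 40 ∧ 0 ≤ 40
      omega
  | some c => exact ⟨hπ, hlen, hd, hbest c rfl⟩

/-- `proceed` preserves the size invariant. [folklore] -/
theorem evInv_proceed {π : List (List Bool × Bool)} {d : ℕ} (hπ : ∀ e ∈ π, e.1.length < W) (hlen : π.length + d ≤ D)
    (hd : 1 ≤ d) {lv : ℕ} {rest next : List (List Bool)} {best : Option (List Bool)}
    (hrest : ∀ u ∈ rest, u.length + lv < W) (hnext : ∀ v ∈ next, v.length + lv ≤ W)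
    (hbest : ∀ c, best = some c → c.length < W) : EvInv W D (proceed π d lv rest next best) := by
  rcases rest with _ | ⟨w, rest⟩
  · rcases lv with _ | lv
    · exact evInv_finish W D hπ hlen hd hbest
    · rcases next with _ | ⟨v, next⟩
      · exact evInv_finish W D hπ hlen hd hbest
      · refine ⟨hπ, hlen, hd, fun u hu => ?_, by simp, hbest⟩
        have := hnext u hu
        omega
  · exact ⟨hπ, hlen, hd, hrest, hnext, hbest⟩

/-- **The transition preserves the size invariant** (together with the auxiliary count bound of the MEAN phase).
[folklore] -/
theorem evInv_evDelta (s : EvState) (b : Bool)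
    (hs : EvInv W D s ∧ (match s.phase with | .means j cnt => cnt < j | _ => True)) :
    EvInv W D (evDelta W s b) ∧ (match (evDelta W s b).phase with | .means j cnt => cnt < j | _ => True) := by
  obtain ⟨⟨hπ, hlen, hph⟩, haux⟩ := hs
  rcases s with ⟨π, d, phase⟩
  simp only at hπ hlen hph haux
  have hfinP : ∀ {d' : ℕ} {best : Option (List Bool)}, 1 ≤ d' → π.length + d' ≤ D → (∀ c, best = some c → c.length < W) →
      (match (finish π d' best).phase with | .means j cnt => cnt < j | _ => True) := by
    intro d' best _ _ _
    cases best <;> simp [finish]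
  have hproP : ∀ {lv : ℕ} {rest next : List (List Bool)} {best : Option (List Bool)},
      (match (proceed π d lv rest next best).phase with | .means j cnt => cnt < j | _ => True) := by
    intro lv rest next best
    rcases rest with _ | ⟨w, rest⟩
    · rcases lv with _ | lv
      · cases best <;> simp [proceed, finish]
      · rcases next with _ | ⟨v, next⟩
        · cases best <;> simp [proceed, finish]
        · simp [proceed]
    · simp [proceed]
  cases phase with
  | root =>
    simp only [evDelta]
    split_ifs with hW hb
    · exact ⟨evInv_finish W D hπ hlen hph (by simp), by simp [finish]⟩
    · refine ⟨⟨hπ, hlen, hph, fun u hu => ?_, by simp, by simp⟩, trivial⟩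
      simp only [List.mem_singleton] at hu
      subst hu; simp; omega
    · exact ⟨evInv_finish W D hπ hlen hph (by simp), by simp [finish]⟩
  | single lv alive next best =>
    obtain ⟨hd, halive, hnext, hbest⟩ := hph
    rcases alive with _ | ⟨u, rest⟩
    · rcases lv with _ | lv <;> exact ⟨⟨hπ, hlen, hd, halive, hnext, hbest⟩, trivial⟩
    · have hbump : ∀ c, bump π b best u = some c → c.length < W := by
        intro c hc
        rcases bump_eq_or π b best u with h | h
        · exact hbest c (h ▸ hc)
        · rw [h] at hc; cases hc; have := halive u (by simp); omega
      rcases lv with _ | lv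
      · exact ⟨evInv_proceed W D hπ hlen hd (fun v hv => halive v (List.mem_cons_of_mem _ hv)) hnext hbump, hproP⟩
      · exact ⟨⟨hπ, hlen, hd, halive, hnext, hbump⟩, trivial⟩
  | block0 lv alive next best =>
    obtain ⟨hd, halive, hnext, hbest⟩ := hph
    rcases alive with _ | ⟨u, rest⟩
    · exact ⟨⟨hπ, hlen, hd, halive, hnext, hbest⟩, trivial⟩
    · refine ⟨⟨hπ, hlen, hd, halive, fun v hv => ?_, hbest⟩, trivial⟩
      split_ifs at hv with hb
      · rcases List.mem_append.1 hv with hv | hv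
        · exact hnext v hv
        · simp only [List.mem_singleton] at hv
          subst hv; have := halive u (by simp); simp; omega
      · exact hnext v hv
  | block1 lv alive next best =>
    obtain ⟨hd, halive, hnext, hbest⟩ := hph
    rcases alive with _ | ⟨u, rest⟩
    · exact ⟨⟨hπ, hlen, hd, halive, hnext, hbest⟩, trivial⟩
    · refine ⟨evInv_proceed W D hπ hlen hd (fun v hv => halive v (List.mem_cons_of_mem _ hv)) (fun v hv => ?_) hbest,
        hproP⟩
      split_ifs at hv with hb
      · rcases List.mem_append.1 hv with hv | hv
        · exact hnext v hv
        · simp only [List.mem_singleton] at hv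
          subst hv; have := halive u (by simp); simp; omega
      · exact hnext v hv
  | aq u =>
    obtain ⟨hd, hu⟩ := hph
    have hπ' : ∀ e ∈ π ++ [(u, b)], e.1.length < W := by
      intro e he
      rcases List.mem_append.1 he with he | he
      · exact hπ e he
      · simp only [List.mem_singleton] at he; subst he; exact hu
    have hlen' : (π ++ [(u, b)]).length + (d - 1) ≤ D := by simp; omega
    simp only [evDelta]
    rcases hd1 : d - 1 with _ | d'
    · rw [hd1] at hlen'
      exact ⟨⟨hπ', by simpa [roundState] using hlen', by simp [roundState]⟩, by simp [roundState]⟩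
    · rw [hd1] at hlen'
      exact ⟨⟨hπ', by simpa [roundState] using hlen', by simp [roundState]⟩, by simp [roundState]⟩
  | means j cnt =>
    obtain ⟨hj, hj40, hcnt⟩ := hph
    simp only at haux
    simp only [evDelta]
    split_ifs with h40 hb
    · exact ⟨⟨hπ, hlen, trivial⟩, trivial⟩
    · exact ⟨⟨hπ, hlen, trivial⟩, trivial⟩
    · exact ⟨⟨hπ, hlen, by simp; omega⟩, by simp; omega⟩
    · exact ⟨⟨hπ, hlen, by simp; omega⟩, by simp; omega⟩
  | done c => exact ⟨⟨hπ, hlen, trivial⟩, trivial⟩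

/-- **Every reachable state satisfies the size invariant.** [folklore] -/
theorem evInv_evState (bits : List Bool) : EvInv W D (evState W D bits) := by
  suffices h : EvInv W D (evState W D bits) ∧
      (match (evState W D bits).phase with | .means j cnt => cnt < j | _ => True) from h.1
  induction bits using List.reverseRecOn with
  | nil =>
    rcases D with _ | d
    · exact ⟨⟨by simp [evState, evInit, roundState], by simp [evState, evInit, roundState],
        by simp [evState, evInit, roundState]⟩, by simp [evState, evInit, roundState]⟩
    · exact ⟨⟨by simp [evState, evInit, roundState], by simp [evState, evInit, roundState],
        by simp [evState, evInit, roundState]⟩, by simp [evState, evInit, roundState]⟩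
  | append_singleton bits b ih =>
    have he : evState W D (bits ++ [b]) = evDelta W (evState W D bits) b := by
      simp [evState, List.foldl_append]
    rw [he]
    exact evInv_evDelta W D _ b ih

/-- `evState` after one more answer bit. [folklore] -/
theorem evState_append_singleton (bits : List Bool) (b : Bool) :
    evState W D (bits ++ [b]) = evDelta W (evState W D bits) b := by
  simp [evState, List.foldl_append]

/-- **Queries of states satisfying the size invariant are short**: at most `evQueryBound W D |x|` (the four query
shapes of `Theorems/SosSandwichTransferPBWalkMachineLength.lean`). [folklore] -/
theorem length_query_le (x : List Bool) {s : EvState} (hs : EvInv W D s) {q : List Bool}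
    (hq : evKappa x s = Sum.inl q) : q.length ≤ evQueryBound W D x.length := by
  obtain ⟨hπ, hlen, hph⟩ := hs
  rcases s with ⟨π, d, phase⟩
  simp only at hπ hlen hph hq
  have hP : π.length ≤ D := by omega
  unfold evQueryBound
  refine length_le_of_shape x hπ hP ?_
  cases phase with
  | root => cases hq; exact Or.inl ⟨[], by simp, Or.inl rfl⟩
  | single lv alive next best =>
    rcases alive with _ | ⟨u, rest⟩
    · cases hq
    · cases hq
      obtain ⟨-, halive, -, -⟩ := hph
      have := halive u (by simp)
      exact Or.inl ⟨u, by omega, Or.inr rfl⟩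
  | block0 lv alive next best =>
    rcases alive with _ | ⟨u, rest⟩
    · cases hq
    · cases hq
      obtain ⟨-, halive, -, -⟩ := hph
      have := halive u (by simp)
      exact Or.inl ⟨u ++ [false], by simp; omega, Or.inl rfl⟩
  | block1 lv alive next best =>
    rcases alive with _ | ⟨u, rest⟩
    · cases hq
    · cases hq
      obtain ⟨-, halive, -, -⟩ := hph
      have := halive u (by simp)
      exact Or.inl ⟨u ++ [true], by simp; omega, Or.inl rfl⟩
  | aq u => cases hq; exact Or.inr (Or.inl ⟨u, hph.2, rfl⟩)
  | means j cnt => cases hq; exact Or.inr (Or.inr ⟨j, hph.2.1, rfl⟩)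
  | done c => cases hq

end Invariant

end SimTreePB

end Summit.QuantumAdvantage.QuantumAdvantage.Cruxes.TransferPB.Birth

end
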